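import Mathlib
import Summits.KontsevichZagierPeriods.Zeta5Search.RecordCellADigitsA
import HarnessLib

/-!
# ζ(5) search — the leading digits of `W_x`, `V_x` at a two-point class of type `(2,2)` and its conjugate

Cell `pub-zeta5` (HONEST FRAMING: systematic search; no irrationality claim unless certified), P1 prover seat
generation 5; part of the Lean proof of census g11's `RecordCellA` (companion of `RecordCellADigitsA.lean`).  For `b` in the
polytope, a window prime `p ≥ 5` and a class `x = {q₀, q₀+p}` (`q₀ < p ≤ q₀+p ≤ b₀ < q₀+2p`) with net exponents `(−2,−2)`
(two double poles, `E_x = −4`; the "even palindromic" type of gen-2's LB♯♯), `g = gTop b p q₀ 0`, conjugate class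
`x̄ = {b₀−q₀−p, b₀−q₀}`:

* `W_x = W_x̄ = 0` EXACTLY (a double pole has no `(y+q)^{−3}` coefficient);
* `p⁴·V_x ≡ 3g` and `p⁴·V_x̄ ≡ −3g (mod p)` — the two constant-term digits CANCEL (the reflection `c_{o,b₀−q} = (−1)^o c_{o,q}`
  flips the sign of the order-2 contribution; this is gen-2 g8's `PairCancellation` shape constant `𝒱 = 3` for two double poles);
* hence the pair congruence `p·(W_x + W_x̄) ≡ p⁴·(V_x + V_x̄) ≡ 0 (mod p)` (`digitS_pair`).
`p`-adic norms of rational numbers; nothing about irrationality.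
-/

noncomputable section

open Finset PowerSeries

namespace Summit.KontsevichZagierPeriods.Zeta5Search.CellA

open Summit.KontsevichZagierPeriods.Zeta5Search.DualSeries (InBox)
open Summit.KontsevichZagierPeriods.Zeta5Search.WedgeDictionary (IsPFData pfData coeffW)
open Summit.KontsevichZagierPeriods.Zeta5Search.CasoratianValuation (InPolytope)
open Summit.KontsevichZagierPeriods.Zeta5Search.ClusterValuation
open Summit.KontsevichZagierPeriods.Zeta5Search.PadicSeries
open Summit.KontsevichZagierPeriods.Zeta5Search.BigPrime (padicNorm_mul_le_one)
open Literature.NumberTheory.Transcendental.BallRivoal (harm)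

variable {p : ℕ} [hp : Fact p.Prime]

section TwoPoint

variable (b : ℕ → ℤ) (hb : InPolytope b) (hp5 : 5 ≤ p) (hwin : (b 0 + 2 : ℤ) < (p : ℤ) ^ 2) {q₀ : ℕ}
  (hq₀ : q₀ < p) (hq₁ : q₀ + p ≤ (b 0).toNat) (htop : (b 0).toNat < q₀ + 2 * p)

omit hp in
/-- A sum over `range 6` whose terms vanish from `o = 2` on. -/
theorem sum_range_six_of_ge_two {f : ℕ → ℚ} (h : ∀ o, 2 ≤ o → o < 6 → f o = 0) :
    ∑ o ∈ range 6, f o = f 0 + f 1 := by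
  simp only [sum_range_succ, sum_range_zero, zero_add, h 2 (by norm_num) (by norm_num), h 3 (by norm_num) (by norm_num),
    h 4 (by norm_num) (by norm_num), h 5 (by norm_num) (by norm_num), add_zero]

/-! ### Type `(2,2)`: the class `x` itself -/

include hb hwin hq₀ hq₁ htop in
/-- **`W_x = 0`** for a class of type `(2,2)`. -/
theorem classW_S (he₀ : netExp b q₀ = -2) (he₁ : netExp b (q₀ + p) = -2) : classW b p q₀ = 0 := by
  obtain ⟨-, -, hz⟩ := pfS_top b hb hwin hq₁ he₀ he₁
  obtain ⟨-, -, hz'⟩ := pfS_bot b hb hwin hq₁ he₀ he₁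
  rw [classW, classSet_twoPoint b hq₀ hq₁ htop hp.out.pos, sum_pair (by have := hp.out.pos; omega),
    hz 2 (by norm_num) (by norm_num), hz' 2 (by norm_num) (by norm_num), add_zero]

include hb hp5 hwin hq₀ hq₁ htop in
/-- **`p⁴·V_x ≡ 3g (mod p)`** for a class of type `(2,2)`. -/
theorem classV_S (he₀ : netExp b q₀ = -2) (he₁ : netExp b (q₀ + p) = -2) :
    padicNorm p ((p : ℚ) ^ 4 * classV b p q₀ - 3 * gTop b p q₀ 0) ≤ (p : ℚ) ^ (-(1 : ℤ)) := by
  have hp0 : (p : ℚ) ≠ 0 := Nat.cast_ne_zero.2 hp.out.ne_zero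
  have hp2 : p ≠ 2 := by have := hp5; omega
  have hn : (b 0).toNat < p ^ 2 := (thmA_data b hb hwin).2.2.2
  obtain ⟨c1, c0, hz⟩ := pfS_top b hb hwin hq₁ he₀ he₁
  obtain ⟨d1, d0, hz'⟩ := pfS_bot b hb hwin hq₁ he₀ he₁
  set g := gTop b p q₀ 0 with hg
  set g₁ := gTop b p q₀ 1 with hg₁
  set g' := gBot b p q₀ 0 with hg'
  set g'₁ := gBot b p q₀ 1 with hg'₁
  have ig : padicNorm p g ≤ 1 := padicNorm_gTop_le b hq₀ hq₁ htop hn hp2 0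
  have ig₁ : padicNorm p g₁ ≤ 1 := padicNorm_gTop_le b hq₀ hq₁ htop hn hp2 1
  have ig' : padicNorm p g' ≤ 1 := padicNorm_gBot_le b hq₀ hq₁ htop hn hp2 0
  have ig'₁ : padicNorm p g'₁ ≤ 1 := padicNorm_gBot_le b hq₀ hq₁ htop hn hp2 1
  have ip : padicNorm p (p : ℚ) ≤ 1 := nI_nat p
  have i2 : padicNorm p (2 : ℚ) ≤ 1 := by simpa using padicNorm.of_nat (p := p) 2
  have hH : ∀ {i : ℕ}, 1 ≤ i → padicNorm p ((p : ℚ) ^ i * harm i (q₀ + p) - 1) ≤ (p : ℚ) ^ (-(1 : ℤ)) :=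
    fun hi => padicNorm_pow_mul_harm_sub_one_le (by omega) (by omega) hi
  have hV : classV b p q₀ = (pfData b 0 q₀ * harm 1 q₀ + pfData b 1 q₀ * harm 2 q₀) +
      (pfData b 0 (q₀ + p) * harm 1 (q₀ + p) + pfData b 1 (q₀ + p) * harm 2 (q₀ + p)) := by
    rw [classV, classSet_twoPoint b hq₀ hq₁ htop hp.out.pos, sum_pair (by have := hp.out.pos; omega),
      sum_range_six_of_ge_two (fun o h2 h6 => by rw [hz' o h2 h6, zero_mul]),
      sum_range_six_of_ge_two (fun o h2 h6 => by rw [hz o h2 h6, zero_mul])]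
  have e : (p : ℚ) ^ 4 * classV b p q₀ - 3 * g =
      ((p * g'₁ - 2 * g') * ((p : ℚ) ^ 1 * harm 1 q₀) + g' * ((p : ℚ) ^ 2 * harm 2 q₀)) +
      ((((p : ℚ) * g₁ + 2 * g) * ((p : ℚ) ^ 1 * harm 1 (q₀ + p)) - 2 * g) +
       (g * ((p : ℚ) ^ 2 * harm 2 (q₀ + p)) - g)) := by
    rw [hV, d0, d1, c0, c1]
    field_simp
    ring
  rw [e]
  have iA : padicNorm p ((p : ℚ) * g'₁ - 2 * g') ≤ 1 := nI_sub (padicNorm_mul_le_one ip ig'₁) (padicNorm_mul_le_one i2 ig')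
  have iB : padicNorm p ((p : ℚ) * g₁ + 2 * g) ≤ 1 := nI_add (padicNorm_mul_le_one ip ig₁) (padicNorm_mul_le_one i2 ig)
  refine small_add (small_add (small_mul iA (padicNorm_pow_mul_harm_le hq₀ le_rfl))
    (small_mul ig' (padicNorm_pow_mul_harm_le hq₀ (by norm_num)))) (small_add ?_ ?_)
  · refine approx_mul iB (hH le_rfl) ?_
    have e1 : (p : ℚ) * g₁ + 2 * g - 2 * g = p * g₁ := by ring
    rw [e1]; exact small_p_mul ig₁
  · refine approx_mul ig (hH (by norm_num)) ?_
    rw [sub_self, padicNorm.zero]; exact zpow_p_nonneg _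

/-! ### Type `(2,2)`: the conjugate class -/

include hb hwin hq₀ hq₁ htop in
/-- **`W_x̄ = 0`** for the conjugate of a class of type `(2,2)`. -/
theorem classW_Sbar (he₀ : netExp b q₀ = -2) (he₁ : netExp b (q₀ + p) = -2) :
    classW b p ((b 0).toNat - (q₀ + p)) = 0 := by
  obtain ⟨hr₀, hr₁, hrtop, hr⟩ := conj_twoPoint_data b hq₀ hq₁ htop
  obtain ⟨-, -, hz⟩ := pfS_top b hb hwin hq₁ he₀ he₁
  obtain ⟨-, -, hz'⟩ := pfS_bot b hb hwin hq₁ he₀ he₁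
  rw [classW, classSet_twoPoint b hr₀ hr₁ hrtop hp.out.pos, sum_pair (by have := hp.out.pos; omega), hr,
    (pfData_conj b hb hq₁ (by norm_num : 2 < 6)).1, (pfData_conj b hb hq₁ (by norm_num : 2 < 6)).2,
    hz 2 (by norm_num) (by norm_num), hz' 2 (by norm_num) (by norm_num), mul_zero, add_zero]

include hb hp5 hwin hq₀ hq₁ htop in
/-- **`p⁴·V_x̄ ≡ −3g (mod p)`** for the conjugate of a class of type `(2,2)` — the opposite digit. -/
theorem classV_Sbar (he₀ : netExp b q₀ = -2) (he₁ : netExp b (q₀ + p) = -2) :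
    padicNorm p ((p : ℚ) ^ 4 * classV b p ((b 0).toNat - (q₀ + p)) + 3 * gTop b p q₀ 0) ≤ (p : ℚ) ^ (-(1 : ℤ)) := by
  have hp0 : (p : ℚ) ≠ 0 := Nat.cast_ne_zero.2 hp.out.ne_zero
  have hp2 : p ≠ 2 := by have := hp5; omega
  have hn : (b 0).toNat < p ^ 2 := (thmA_data b hb hwin).2.2.2
  obtain ⟨hr₀, hr₁, hrtop, hr⟩ := conj_twoPoint_data b hq₀ hq₁ htop
  obtain ⟨c1, c0, hz⟩ := pfS_top b hb hwin hq₁ he₀ he₁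
  obtain ⟨d1, d0, hz'⟩ := pfS_bot b hb hwin hq₁ he₀ he₁
  set r₀ := (b 0).toNat - (q₀ + p) with hr₀def
  set g := gTop b p q₀ 0 with hg
  set g₁ := gTop b p q₀ 1 with hg₁
  set g' := gBot b p q₀ 0 with hg'
  set g'₁ := gBot b p q₀ 1 with hg'₁
  have ig : padicNorm p g ≤ 1 := padicNorm_gTop_le b hq₀ hq₁ htop hn hp2 0
  have ig₁ : padicNorm p g₁ ≤ 1 := padicNorm_gTop_le b hq₀ hq₁ htop hn hp2 1
  have ig' : padicNorm p g' ≤ 1 := padicNorm_gBot_le b hq₀ hq₁ htop hn hp2 0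
  have ig'₁ : padicNorm p g'₁ ≤ 1 := padicNorm_gBot_le b hq₀ hq₁ htop hn hp2 1
  have ip : padicNorm p (p : ℚ) ≤ 1 := nI_nat p
  have i2 : padicNorm p (2 : ℚ) ≤ 1 := by simpa using padicNorm.of_nat (p := p) 2
  have hgg : padicNorm p (g' - g) ≤ (p : ℚ) ^ (-(1 : ℤ)) := by
    rw [← padicNorm.neg, neg_sub]; exact padicNorm_gTop_sub_gBot_le b hq₀ hq₁ htop hn
  have hc : ∀ o, o < 6 → pfData b o r₀ = (-1 : ℚ) ^ o * pfData b o (q₀ + p) := fun o ho => (pfData_conj b hb hq₁ ho).1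
  have hc' : ∀ o, o < 6 → pfData b o (r₀ + p) = (-1 : ℚ) ^ o * pfData b o q₀ := fun o ho => by
    rw [hr]; exact (pfData_conj b hb hq₁ ho).2
  have hV : classV b p r₀ =
      (pfData b 0 (q₀ + p) * harm 1 r₀ - pfData b 1 (q₀ + p) * harm 2 r₀) +
        (pfData b 0 q₀ * harm 1 (r₀ + p) - pfData b 1 q₀ * harm 2 (r₀ + p)) := by
    rw [classV, classSet_twoPoint b hr₀ hr₁ hrtop hp.out.pos, sum_pair (by have := hp.out.pos; omega),
      sum_range_six_of_ge_two (fun o h2 h6 => by rw [hc o h6, hz o h2 h6, mul_zero, zero_mul]),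
      sum_range_six_of_ge_two (fun o h2 h6 => by rw [hc' o h6, hz' o h2 h6, mul_zero, zero_mul]),
      hc 0 (by norm_num), hc 1 (by norm_num), hc' 0 (by norm_num), hc' 1 (by norm_num)]
    ring
  have e : (p : ℚ) ^ 4 * classV b p r₀ + 3 * g =
      ((((p : ℚ) * g₁ + 2 * g) * ((p : ℚ) ^ 1 * harm 1 r₀)) - g * ((p : ℚ) ^ 2 * harm 2 r₀)) +
      ((((p : ℚ) * g'₁ - 2 * g') * ((p : ℚ) ^ 1 * harm 1 (r₀ + p)) - (-2 * g)) -
       (g' * ((p : ℚ) ^ 2 * harm 2 (r₀ + p)) - g)) := by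
    rw [hV, d0, d1, c0, c1]
    field_simp
    ring
  rw [e]
  have iA : padicNorm p ((p : ℚ) * g'₁ - 2 * g') ≤ 1 := nI_sub (padicNorm_mul_le_one ip ig'₁) (padicNorm_mul_le_one i2 ig')
  have iB : padicNorm p ((p : ℚ) * g₁ + 2 * g) ≤ 1 := nI_add (padicNorm_mul_le_one ip ig₁) (padicNorm_mul_le_one i2 ig)
  refine small_add (small_sub (small_mul iB (padicNorm_pow_mul_harm_le hr₀ le_rfl))
    (small_mul ig (padicNorm_pow_mul_harm_le hr₀ (by norm_num)))) (small_sub ?_ ?_)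
  · refine approx_mul iA (padicNorm_pow_mul_harm_sub_one_le (by omega) (by omega) le_rfl) ?_
    have e1 : (p : ℚ) * g'₁ - 2 * g' - -2 * g = p * g'₁ - 2 * (g' - g) := by ring
    rw [e1]; exact small_sub (small_p_mul ig'₁) (small_mul i2 hgg)
  · exact approx_mul ig' (padicNorm_pow_mul_harm_sub_one_le (by omega) (by omega) (by norm_num)) hgg

/-! ### Type `(2,2)`: the pair package -/

include hb hp5 hwin hq₀ hq₁ htop in
/-- **TYPE `(2,2)` DIGIT PACKAGE**: `p·W` and `p⁴·V` are `p`-integral on the class and its conjugate, and the pair congruence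
`p·(W_x + W_x̄) ≡ p⁴·(V_x + V_x̄) (mod p)` holds (both sides `≡ 0`: the `V`-digits `3g` and `−3g` cancel). -/
theorem digitS_pair (he₀ : netExp b q₀ = -2) (he₁ : netExp b (q₀ + p) = -2) :
    padicNorm p ((p : ℚ) * classW b p q₀) ≤ 1 ∧ padicNorm p ((p : ℚ) ^ 4 * classV b p q₀) ≤ 1 ∧
    padicNorm p ((p : ℚ) * classW b p ((b 0).toNat - (q₀ + p))) ≤ 1 ∧
    padicNorm p ((p : ℚ) ^ 4 * classV b p ((b 0).toNat - (q₀ + p))) ≤ 1 ∧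
    padicNorm p (digitDefect b p q₀ + digitDefect b p ((b 0).toNat - (q₀ + p))) ≤ (p : ℚ) ^ (-(1 : ℤ)) := by
  have hp2 : p ≠ 2 := by have := hp5; omega
  have hn : (b 0).toNat < p ^ 2 := (thmA_data b hb hwin).2.2.2
  have ig : padicNorm p (gTop b p q₀ 0) ≤ 1 := padicNorm_gTop_le b hq₀ hq₁ htop hn hp2 0
  have hW := classW_S b hb hwin hq₀ hq₁ htop he₀ he₁
  have hW' := classW_Sbar b hb hwin hq₀ hq₁ htop he₀ he₁
  have hV := classV_S b hb hp5 hwin hq₀ hq₁ htop he₀ he₁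
  have hV' := classV_Sbar b hb hp5 hwin hq₀ hq₁ htop he₀ he₁
  have i3 : padicNorm p (3 : ℚ) ≤ 1 := by simpa using padicNorm.of_nat (p := p) 3
  have i3g : padicNorm p (3 * gTop b p q₀ 0) ≤ 1 := padicNorm_mul_le_one i3 ig
  refine ⟨?_, ?_, ?_, ?_, ?_⟩
  · rw [hW, mul_zero, padicNorm.zero]; exact zero_le_one
  · have e : (p : ℚ) ^ 4 * classV b p q₀ = ((p : ℚ) ^ 4 * classV b p q₀ - 3 * gTop b p q₀ 0) + 3 * gTop b p q₀ 0 := by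
      ring
    rw [e]; exact nI_add (nI_of_small hV) i3g
  · rw [hW', mul_zero, padicNorm.zero]; exact zero_le_one
  · have e : (p : ℚ) ^ 4 * classV b p ((b 0).toNat - (q₀ + p)) =
        ((p : ℚ) ^ 4 * classV b p ((b 0).toNat - (q₀ + p)) + 3 * gTop b p q₀ 0) - 3 * gTop b p q₀ 0 := by ring
    rw [e]; exact nI_sub (nI_of_small hV') i3g
  · have e : digitDefect b p q₀ + digitDefect b p ((b 0).toNat - (q₀ + p)) =
        -(((p : ℚ) ^ 4 * classV b p q₀ - 3 * gTop b p q₀ 0)) -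
          (((p : ℚ) ^ 4 * classV b p ((b 0).toNat - (q₀ + p)) + 3 * gTop b p q₀ 0)) := by
      unfold digitDefect; rw [hW, hW']; ring
    rw [e]
    exact small_sub ((padicNorm.neg (p := p) _).le.trans hV) hV'

end TwoPoint

end Summit.KontsevichZagierPeriods.Zeta5Search.CellA

end
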